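import Mathlib
import Literature.AlgebraicGeometry.Resolution.AdicOrderBasics
import Summits.ResolutionOfSingularities.ResolutionOfSingularities.Theorems.WeightedInvariantContactCentreFiltration
import HarnessLib

/-!
# The intrinsic centre filtration `jContact` (door `HypersurfaceCentreConstruction`, stmt-ResolutionOfSingularities-19897,
# rung P2): BASIC THEORY on local rings — the contact ladder, unit twins, images, transport, (c6-J) iso-invariance,
# (c12a-J) unit invariance

Topic: `Summits/ResolutionOfSingularities/ResolutionOfSingularities/Theorems`. Helper for the door item
`HypersurfaceCentreConstruction` (statement `stmt-ResolutionOfSingularities-19897`, route `WeightedInvariant`), line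
`local-engine` of res-L1-w43-plan-1 (L W4.3), RULING gen 9 #4 (3) ORDER **(o24-D)** (2026-08-27T07:58:51Z), DESIGN of
res-type-092 08:06:47Z + plan-1 CONSENT 08:07:54Z / AMENDMENTS v1.1 08:05:47Z (res-type-070 INPUT 08:01:57Z, res-type-078
REVIEW 08:05:35Z) and v1.2 08:24:16Z (res-type-078 REVIEW #2 08:21:32Z: uniform junk); res-type-073 REVIEW 08:14:17Z.
Def-free sibling of the definitions module `…ContactCentreFiltration`; the regular-local-ring theory (CASE A, DVR, CASE B =
canonicity, the K6 family `one_le_bMax_and_reaches`) is the third file `…ContactCentreFiltrationRegular`.  Typer res-type-092.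

[OURS · L1 W4.3] Replaces the role of NO printed item; NOT a statement of the manuscript
[claim: Hironaka2017, status: under-review]. AI work, weaker than expert review.

## Contents (sorry-free, standard axioms; no definitions; every statement on an arbitrary LOCAL ring)

* the contact ladder, named forms of res-type-078's `…ContactFiltrationCanonical` §Basic: `pow_le_contactFiltration`,
  `span_pow_le_contactFiltration`, `contactFiltration_zero_weight` (`b = 0`: `𝔪^n`), `contactFiltration_one_weight`,
  `contactFiltration_level_le_span_pow_sup_pow` (level `bν ⊆ (g^ν) + 𝔪^b`, the K6 membership shape),
  `contactFiltration_weight_anti` / `Reaches.of_le` (reached levels are DOWNWARD CLOSED — res-type-078's export (i)),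
  `reaches_one`, **`bMax_eq_of_reaches_of_not_reaches_succ`** (excellence-free, pure `Nat.sSup` bookkeeping: one reached
  level `b ≥ 1` + level `b+1` not reached ⇒ `bMax = b`; the wrapper for res-type-078's C5 `…ContactFiltrationTerminal`
  (p513413) / res-type-098's K5/K7 terminal systems — export (iii));
* unit twins `contactFiltration_unit_mul`, `isMonomialType_unit_mul_iff`, `reaches_unit_mul_iff`, `adicOrder_unit_mul_left`,
  `bMax_unit_mul`, `jContactLocal_unit_mul`; images under homomorphisms with `φ(𝔪) ⊆ 𝔪'`
  (`map_contactFiltration_le_of_map_maximalIdeal_le`, res-type-073 (N2)); transport along `≃+*`: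
  `map_contactFiltration_ringEquiv`, `apply_mem_contactFiltration_iff`, `isMonomialType_ringEquiv_iff`,
  `carries_ringEquiv_iff`, `reaches_ringEquiv_iff`, `bMax_ringEquiv`, `map_jContactLocal_ringEquiv`;
* **(c6-J) `jContact_isoInvariant : JIsoInvariant jContact`** and **(c12a-J) `jContact_unitInvariant : JUnitInvariant jContact`**
  — pure transport on EVERY commutative ring (design notes (R1)/(R4) of the defs module: no canonicity is used).

## References

* H. Hironaka, *Characteristic polyhedra of singularities*, J. Math. Kyoto Univ. 7 (1967) 251–293. [Hironaka1967]
* O. Zariski, P. Samuel, *Commutative Algebra* II, Ch. VIII §1 (order of an element of a local ring). [ZariskiSamuel1960]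
* res-L1-w43-plan-1, `CRUX-PLAN.md` §v8, `p2_jdef_sketch_v1(_1).lean` (OURS, AI planning).
-/

noncomputable section

open IsLocalRing Literature.AlgebraicGeometry.Resolution
open Summit.ResolutionOfSingularities.ResolutionOfSingularities.Theorems

set_option linter.dupNamespace false -- mandated namespace of this single-conjunct summit

namespace Summit.ResolutionOfSingularities.ResolutionOfSingularities.Cruxes.HypersurfaceCentreConstruction.LocalEngine

universe u

variable {S : Type u} [CommRing S]

/-! ## The contact filtration: elementary inclusions (named forms of `…ContactFiltrationCanonical` §Basic) -/

section Basic

variable [IsLocalRing S]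

/-- `𝔪^n ≤ contactFiltration g b n` (the piece `j = 0`). [folklore] -/
theorem pow_le_contactFiltration (g : S) (b n : ℕ) : maximalIdeal S ^ n ≤ contactFiltration g b n :=
  ContactFiltration.pow_le g b n

/-- `(g^ν) ≤ contactFiltration g b (b ν)` (the piece `j = ν`). [folklore] -/
theorem span_pow_le_contactFiltration (g : S) (b ν : ℕ) :
    Ideal.span {g ^ ν} ≤ contactFiltration g b (b * ν) := by
  have h := ContactFiltration.piece_le g b (b * ν) ν
  rwa [Nat.sub_self, pow_zero, Ideal.one_eq_top, Ideal.mul_top] at h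

/-- Weight `0`: `contactFiltration g 0 n = 𝔪^n`. [folklore] -/
theorem contactFiltration_zero_weight (g : S) (n : ℕ) : contactFiltration g 0 n = maximalIdeal S ^ n := by
  refine le_antisymm (iSup_le fun j => ?_) (pow_le_contactFiltration g 0 n)
  rw [zero_mul, Nat.sub_zero]
  exact Ideal.mul_le_left

/-- Weight `1` (`g ∈ 𝔪`): `contactFiltration g 1 n = 𝔪^n`. [folklore] -/
theorem contactFiltration_one_weight {g : S} (hg : g ∈ maximalIdeal S) (n : ℕ) :
    contactFiltration g 1 n = maximalIdeal S ^ n :=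
  ContactFiltration.contactFiltration_one_eq_pow hg n

/-- Level `b ν` lies in `(g^ν) + 𝔪^b`: the pieces `j ≥ ν` are multiples of `g^ν`, the pieces `j < ν` lie in
`𝔪^{b(ν - j)} ⊆ 𝔪^b` (the membership shape consumed by K6 `exists_associated_pow_of_adicSteepening`). [folklore] -/
theorem contactFiltration_level_le_span_pow_sup_pow (g : S) (b ν : ℕ) :
    contactFiltration g b (b * ν) ≤ Ideal.span {g ^ ν} ⊔ maximalIdeal S ^ b := by
  refine iSup_le fun j => ?_
  by_cases hj : ν ≤ j
  · refine le_trans Ideal.mul_le_right (le_trans ?_ le_sup_left)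
    rw [Ideal.span_singleton_le_iff_mem, Ideal.mem_span_singleton]
    exact pow_dvd_pow g hj
  · refine le_trans Ideal.mul_le_left (le_trans (Ideal.pow_le_pow_right ?_) le_sup_right)
    have h : b * (j + 1) ≤ b * ν := Nat.mul_le_mul_left b (not_le.mp hj)
    rw [Nat.mul_succ] at h
    omega

/-- The reached levels are DOWNWARD CLOSED: for `b ≤ b'`, level `b' ν` of weight `b'` lies in level `b ν` of weight `b`.
[folklore] -/
theorem contactFiltration_weight_anti (g : S) {b b' : ℕ} (hbb' : b ≤ b') (ν : ℕ) :
    contactFiltration g b' (b' * ν) ≤ contactFiltration g b (b * ν) := by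
  refine iSup_le fun j => le_trans (Ideal.mul_mono_right (Ideal.pow_le_pow_right ?_))
    (ContactFiltration.piece_le g b _ j)
  rw [← mul_tsub, ← mul_tsub]
  exact Nat.mul_le_mul_right _ hbb'

/-- `Reaches` is downward closed in the level. [folklore] -/
theorem Reaches.of_le {f : S} {ν b b' : ℕ} (h : Reaches f ν b') (hbb' : b ≤ b') : Reaches f ν b := by
  obtain ⟨g, hg, hg', hf⟩ := h
  exact ⟨g, hg, hg', contactFiltration_weight_anti g hbb' ν hf⟩

/-- Level `1` is reached by `f ∈ 𝔪^ν` as soon as a regular parameter exists. [folklore] -/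
theorem reaches_one {f : S} {ν : ℕ} (hf : f ∈ maximalIdeal S ^ ν)
    (hpar : ∃ g ∈ maximalIdeal S, g ∉ maximalIdeal S ^ 2) : Reaches f ν 1 := by
  obtain ⟨g, hg, hg'⟩ := hpar
  refine ⟨g, hg, hg', ?_⟩
  rw [contactFiltration_one_weight hg, one_mul]
  exact hf

/-- **`b_max` from ONE reached level and ONE non-reached level** (excellence-free, pure order theory on `Nat.sSup`): if
level `b ≥ 1` is reached and level `b + 1` is not, then `bMax f = b` (the reached levels are downward closed).  This is the
wrapper through which a TERMINAL system of the dimension-two steepening process (res-type-078's C5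
`not_mem_succ_of_caseC/D`, res-type-098's K5/K7) determines `b_max`. [OURS · L1 W4.3 · (o24-D)] -/
theorem bMax_eq_of_reaches_of_not_reaches_succ {f : S} {b : ℕ} (hb : 1 ≤ b) (h : Reaches f (adicOrder f).toNat b)
    (h' : ¬ Reaches f (adicOrder f).toNat (b + 1)) : bMax f = b := by
  have hub : ∀ b' ∈ {b' : ℕ | 1 ≤ b' ∧ Reaches f (adicOrder f).toNat b'}, b' ≤ b := by
    rintro b' ⟨-, hb'⟩
    by_contra hlt
    exact h' (hb'.of_le (by omega))
  rw [bMax_def]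
  exact le_antisymm (csSup_le ⟨b, hb, h⟩ hub) (le_csSup ⟨b, hub⟩ ⟨hb, h⟩)

/-! ### Unit invariance of the objects -/

/-- The contact filtration of `v g` is that of `g` for a unit `v`. [folklore] -/
theorem contactFiltration_unit_mul {v : S} (hv : IsUnit v) (g : S) (b n : ℕ) :
    contactFiltration (v * g) b n = contactFiltration g b n :=
  ContactFiltration.contactFiltration_unit_mul hv g b n

/-- Monomial type is invariant under units. [folklore] -/
theorem IsMonomialType.unit_mul {f : S} (h : IsMonomialType f) {v : S} (hv : IsUnit v) : IsMonomialType (v * f) := by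
  obtain ⟨w, g, ν, hw, hg, hg', rfl⟩ := h
  exact ⟨v * w, g, ν, hv.mul hw, hg, hg', by rw [mul_assoc]⟩

/-- Monomial type is invariant under units (iff form). [folklore] -/
theorem isMonomialType_unit_mul_iff {v : S} (hv : IsUnit v) (f : S) : IsMonomialType (v * f) ↔ IsMonomialType f := by
  refine ⟨fun h => ?_, fun h => h.unit_mul hv⟩
  obtain ⟨u, rfl⟩ := hv
  have h' := h.unit_mul (u⁻¹).isUnit
  rwa [Units.inv_mul_cancel_left] at h'

/-- `Reaches` is invariant under units. [folklore] -/
theorem reaches_unit_mul_iff {v : S} (hv : IsUnit v) (f : S) (ν b : ℕ) : Reaches (v * f) ν b ↔ Reaches f ν b :=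
  exists_congr fun _ => and_congr_right fun _ => and_congr_right fun _ => Ideal.unit_mul_mem_iff_mem _ hv

/-- The order is invariant under units (any local ring; `adicOrder_mul_of_isUnit_right` of the tree). [folklore] -/
theorem adicOrder_unit_mul_left {v : S} (hv : IsUnit v) (f : S) : adicOrder (v * f) = adicOrder f := by
  rw [mul_comm, adicOrder_mul_of_isUnit_right f hv]

/-- `bMax` is invariant under units. [folklore] -/
theorem bMax_unit_mul {v : S} (hv : IsUnit v) (f : S) : bMax (v * f) = bMax f := by
  simp only [bMax_def, adicOrder_unit_mul_left hv, reaches_unit_mul_iff hv]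

/-- `jContactLocal` is invariant under units (the `JUnitInvariant` shape). [folklore] -/
theorem jContactLocal_unit_mul {v : S} (hv : IsUnit v) (f : S) (m : ℕ) : jContactLocal (v * f) m = jContactLocal f m := by
  by_cases hf0 : f = 0
  · subst hf0
    rw [mul_zero]
  have hvf0 : v * f ≠ 0 := fun h => hf0 (hv.mul_right_eq_zero.mp h)
  by_cases hfu : IsUnit f
  · rw [jContactLocal_of_isUnit hfu, jContactLocal_of_isUnit (hv.mul hfu)]
  have hvfu : ¬ IsUnit (v * f) := fun h => hfu (isUnit_of_mul_isUnit_right h)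
  by_cases hf : IsMonomialType f
  · rw [jContactLocal_of_isMonomialType hf0 hfu hf,
      jContactLocal_of_isMonomialType hvf0 hvfu ((isMonomialType_unit_mul_iff hv f).mpr hf),
      Ideal.span_singleton_mul_left_unit hv]
  · have hf' : ¬ IsMonomialType (v * f) := fun h => hf ((isMonomialType_unit_mul_iff hv f).mp h)
    rw [jContactLocal_of_not_isMonomialType hf0 hfu hf, jContactLocal_of_not_isMonomialType hvf0 hvfu hf',
      bMax_unit_mul hv, adicOrder_unit_mul_left hv]
    simp_rw [Ideal.unit_mul_mem_iff_mem _ hv]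

end Basic

/-! ### Images under local homomorphisms and transport along ring isomorphisms -/

section Equiv

variable {T : Type u} [CommRing T] [IsLocalRing S] [IsLocalRing T]

/-- Under a ring homomorphism `φ` with `φ(𝔪_S) ⊆ 𝔪_T` (e.g. a local homomorphism, a localisation map of a model at a
prime of the stratum) the image of the contact filtration of `g` lies in that of `φ g` (res-type-073's (N2) for (o24-O)).
[folklore] -/
theorem map_contactFiltration_le_of_map_maximalIdeal_le (φ : S →+* T) (hφ : (maximalIdeal S).map φ ≤ maximalIdeal T)
    (g : S) (b n : ℕ) : (contactFiltration g b n).map φ ≤ contactFiltration (φ g) b n := by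
  rw [contactFiltration_def, contactFiltration_def, Ideal.map_iSup]
  refine iSup_mono fun j => ?_
  rw [Ideal.map_mul, Ideal.map_pow, Ideal.map_span, Set.image_singleton, map_pow]
  exact Ideal.mul_mono_right (Ideal.pow_right_mono hφ _)

/-- `e x ∈ 𝔪_T ↔ x ∈ 𝔪_S`. [folklore] -/
theorem apply_mem_maximalIdeal_iff (e : S ≃+* T) (x : S) : e x ∈ maximalIdeal T ↔ x ∈ maximalIdeal S := by
  rw [← map_ringEquiv_maximalIdeal e, Ideal.apply_mem_of_equiv_iff]

/-- `e x ∈ 𝔪_T^n ↔ x ∈ 𝔪_S^n`. [folklore] -/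
theorem apply_mem_maximalIdeal_pow_iff (e : S ≃+* T) (x : S) (n : ℕ) :
    e x ∈ maximalIdeal T ^ n ↔ x ∈ maximalIdeal S ^ n := by
  rw [← map_ringEquiv_maximalIdeal e, ← Ideal.map_pow, Ideal.apply_mem_of_equiv_iff]

/-- A ring isomorphism transports the contact filtration of `g` to that of `e g` (named form of
`ContactFiltration.map_contactFiltration_ringEquiv`). [folklore] -/
theorem map_contactFiltration_ringEquiv (e : S ≃+* T) (g : S) (b n : ℕ) :
    (contactFiltration g b n).map e = contactFiltration (e g) b n := by
  rw [contactFiltration_def, contactFiltration_def, Ideal.map_iSup]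
  refine iSup_congr fun j => ?_
  rw [Ideal.map_mul, Ideal.map_pow, Ideal.map_span, Set.image_singleton, map_ringEquiv_maximalIdeal e, map_pow]

/-- `e f ∈ contactFiltration (e g) b n ↔ f ∈ contactFiltration g b n`. [folklore] -/
theorem apply_mem_contactFiltration_iff (e : S ≃+* T) (f g : S) (b n : ℕ) :
    e f ∈ contactFiltration (e g) b n ↔ f ∈ contactFiltration g b n := by
  rw [← map_contactFiltration_ringEquiv, Ideal.apply_mem_of_equiv_iff]

/-- Monomial type is transported by ring isomorphisms. [folklore] -/
theorem IsMonomialType.map_ringEquiv {f : S} (h : IsMonomialType f) (e : S ≃+* T) : IsMonomialType (e f) := by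
  obtain ⟨v, g, ν, hv, hg, hg', rfl⟩ := h
  exact ⟨e v, e g, ν, hv.map e, (apply_mem_maximalIdeal_iff e g).mpr hg,
    fun h => hg' ((apply_mem_maximalIdeal_pow_iff e g 2).mp h), by rw [map_mul, map_pow]⟩

/-- Monomial type is invariant under ring isomorphisms. [folklore] -/
theorem isMonomialType_ringEquiv_iff (e : S ≃+* T) (f : S) : IsMonomialType (e f) ↔ IsMonomialType f := by
  refine ⟨fun h => ?_, fun h => h.map_ringEquiv e⟩
  have h' := h.map_ringEquiv e.symm
  rwa [e.symm_apply_apply] at h'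

/-- The maximiser predicate is transported by ring isomorphisms. [folklore] -/
theorem carries_ringEquiv_iff (e : S ≃+* T) (f g : S) (b n : ℕ) :
    (e g ∈ maximalIdeal T ∧ e g ∉ maximalIdeal T ^ 2 ∧ e f ∈ contactFiltration (e g) b n) ↔
      (g ∈ maximalIdeal S ∧ g ∉ maximalIdeal S ^ 2 ∧ f ∈ contactFiltration g b n) := by
  rw [apply_mem_maximalIdeal_iff, apply_mem_maximalIdeal_pow_iff, apply_mem_contactFiltration_iff]

/-- `Reaches` is invariant under ring isomorphisms. [folklore] -/
theorem reaches_ringEquiv_iff (e : S ≃+* T) (f : S) (ν b : ℕ) : Reaches (e f) ν b ↔ Reaches f ν b := by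
  constructor
  · rintro ⟨g', hg'⟩
    refine ⟨e.symm g', (carries_ringEquiv_iff e f (e.symm g') b (b * ν)).mp ?_⟩
    rwa [e.apply_symm_apply]
  · rintro ⟨g, hg⟩
    exact ⟨e g, (carries_ringEquiv_iff e f g b (b * ν)).mpr hg⟩

/-- `bMax` is invariant under ring isomorphisms. [folklore] -/
theorem bMax_ringEquiv (e : S ≃+* T) (f : S) : bMax (e f) = bMax f := by
  simp only [bMax_def, adicOrder_map_ringEquiv, reaches_ringEquiv_iff]

/-- `jContactLocal` is transported by ring isomorphisms (the `JIsoInvariant` shape). [folklore] -/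
theorem map_jContactLocal_ringEquiv (e : S ≃+* T) (f : S) (m : ℕ) :
    (jContactLocal f m).map e = jContactLocal (e f) m := by
  by_cases hf0 : f = 0
  · subst hf0
    rw [map_zero, jContactLocal_zero, jContactLocal_zero, Ideal.map_bot]
  have hef0 : e f ≠ 0 := e.map_ne_zero_iff.mpr hf0
  by_cases hfu : IsUnit f
  · rw [jContactLocal_of_isUnit hfu, jContactLocal_of_isUnit (hfu.map e), Ideal.map_top]
  have hefu : ¬ IsUnit (e f) := fun h => hfu (by simpa using h.map e.symm)
  by_cases hf : IsMonomialType f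
  · rw [jContactLocal_of_isMonomialType hf0 hfu hf,
      jContactLocal_of_isMonomialType hef0 hefu ((isMonomialType_ringEquiv_iff e f).mpr hf),
      Ideal.map_pow, ← Ideal.comap_symm, Ideal.comap_radical, Ideal.comap_symm, Ideal.map_span, Set.image_singleton]
  · have hf' : ¬ IsMonomialType (e f) := fun h => hf ((isMonomialType_ringEquiv_iff e f).mp h)
    rw [jContactLocal_of_not_isMonomialType hf0 hfu hf, jContactLocal_of_not_isMonomialType hef0 hefu hf',
      bMax_ringEquiv, adicOrder_map_ringEquiv, Ideal.map_sup, Ideal.map_pow, map_ringEquiv_maximalIdeal e,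
      Ideal.map_iSup]
    congr 1
    refine Eq.trans (iSup_congr fun g => ?_) (e.surjective.iSup_comp _)
    rw [Ideal.map_iSup, map_contactFiltration_ringEquiv]
    exact iSup_congr_Prop (carries_ringEquiv_iff e f g (bMax f) _).symm fun _ => rfl

end Equiv

/-! ## (c6-J) and (c12a-J): iso- and unit-invariance of `jContact` -/

/-- **(c6-J) `jContact` is invariant under ring isomorphisms** (`JIsoInvariant jContact`): transport of structure through
every branch of the definition (no canonicity is used; `0 ↦ ⊥`, units `↦ ⊤` transport trivially); off the local rings
both sides are `⊤`.
[OURS · L1 W4.3 · (o24-D)] -/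
theorem jContact_isoInvariant : JIsoInvariant jContact := by
  intro R T _ _ e g m
  by_cases hR : IsLocalRing R
  · haveI : IsLocalRing T := e.isLocalRing
    rw [jContact_eq, jContact_eq, map_jContactLocal_ringEquiv]
  · have hT : ¬ IsLocalRing T := fun hT => hR e.symm.isLocalRing
    rw [jContact_of_not_isLocalRing R hR, jContact_of_not_isLocalRing T hT, Ideal.map_top]

/-- **(c12a-J) `jContact` is invariant under units** (`JUnitInvariant jContact`): every branch depends on the ideal
`(f)` and on memberships of `f` in ideals only. [OURS · L1 W4.3 · (o24-D)] -/
theorem jContact_unitInvariant : JUnitInvariant jContact := by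
  intro R _ v g m hv
  by_cases hR : IsLocalRing R
  · rw [jContact_eq, jContact_eq, jContactLocal_unit_mul hv]
  · rw [jContact_of_not_isLocalRing R hR, jContact_of_not_isLocalRing R hR]

end Summit.ResolutionOfSingularities.ResolutionOfSingularities.Cruxes.HypersurfaceCentreConstruction.LocalEngine

end
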